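import Mathlib
import Summits.Ventures.FusionMHD.Models.SAlphaStableCore0
import HarnessLib

/-!
# STABLE-POINT core, piece 3 (`[11/2, 7]`): kernel-decided Taylor-model leaves ⇒ `F_3 > 0` and `amplitudeResidual 1 (2/5) F_3 F_3″ ≤ 0` on the piece ⇒ `EnergyDominatesOn` for its amplitude phase

LADDER-GRIDFUSION rung F3 («#209-cand F3.BALLOON-sα-STABLE-POINT-THM»); gridfusion-model-7 g8, 2026-08-28.  Two `decide +kernel` calls
(`OpModel.trig.pLeavesCheck`, scale `2^60`, Taylor degree 10, 12 leaves of half-width 1/16) and the lane's soundness theorem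
`OpSem.trig.pos_of_pLeavesCheck` (Literature/Analysis/ValidatedNumerics/TaylorModelZeroCert) give the two sign facts; lit-4's
`energyDominatesOn_of_amplitude` (Literature/MathematicalPhysics/MHD/BallooningSAlphaStableSide) turns them into energy domination by the
phase `amplitudePhase 1 (2/5) F_3 F_3′` on the piece.  MODELLED: `s–α` model; nothing about a device.  No `native_decide`.
Citations: Freidberg 2014 §12.6.2 (12.97) [Freidberg2014]; Makino–Berz 2003 Alg. 2 [MakinoBerz2003]; Hartman 2002 XI.6.2 [Hartman2002].
Everything here is [instance data].
-/

open Literature.Analysis.ValidatedNumerics Literature.Analysis.ValidatedNumerics.PolyMP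
open Literature.Analysis.ValidatedNumerics.NumericsMP Literature.Analysis.ValidatedNumerics.ExpPoly
open Literature.MathematicalPhysics.MHD.Ballooning
open Real Set

namespace Summit.Ventures.FusionMHD.Models

namespace SAlphaStableCore

-- (program semantics and the leaf lemmas are in `SAlphaStableCore0`)

/-- KERNEL CHECK (residual leaves of piece 3). [instance data] -/
theorem res3_ok : OpModel.trig.pLeavesCheck prm (2 ^ 60) (coreProg P3 (Poly.deriv (Poly.deriv P3))) [] leaves3 = true := by
  decide +kernel

/-- KERNEL CHECK (positivity leaves of piece 3). [instance data] -/
theorem pos3_ok : OpModel.trig.pLeavesCheck prm (2 ^ 60) (posProg P3) [] leaves3 = true := by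
  decide +kernel

/-- The leaves tile `[11/2, 7]`. [instance data] -/
theorem tiles3 : tiles (11/2 : ℚ) (leaves3.map fun l => (l.e, l.k)) (7 : ℚ) = true := by
  decide +kernel

/-- **PIECE 3**: the phase of `F_3` dominates the `s–α` energy on `[11/2, 7]` at `(s, α) = (1, 2/5)`. [instance data] -/
theorem dominates3 :
    SAlpha.EnergyDominatesOn 1 (2 / 5) (SAlpha.amplitudePhase 1 (2 / 5) (Poly.eval P3) (Poly.eval (Poly.deriv P3)))
      (Icc (11/2 : ℝ) (7 : ℝ)) := by
  have h := dominates_of_leaves (lf := P3) (x := 11/2) (y := 7) (by norm_num) tiles3 res3_ok pos3_ok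
  norm_num at h
  exact h

end SAlphaStableCore

end Summit.Ventures.FusionMHD.Models
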